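import Literature.Analysis.FluidPDE.Wei2016Lemma23
import Literature.Analysis.FluidPDE.AxisymHouLiVariables
import HarnessLib

/-!
# Wei 2016, (3.5): Lemma 2.3 (2.4) applied to `f = ∇(u_r/r)`, in gradient form

Analysis/FluidPDE proof file (theorems only; no definitions, no named facts) on the way to
`Literature.Analysis.FluidPDE.Wei2016_logModulus_regularity`
(`LeiZhang2017AxisymmetricCriteria.lean`), after

* D. Wei, *Regularity criterion to the axially symmetric Navier–Stokes equations*, J. Math.
  Anal. Appl. 435 (2016) 402–413 = arXiv:1508.03318, §3, (3.5): "Choosing `f = ∂ᵣ(u_r/r),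
  ∂_z(u_r/r)` in (2.4), we have
  `‖u_θ∇(u_r/r)‖² ≤ ε^{2/3} ∫|∂ᵣ∇(u_r/r)|² + C ε^{2/3}(1 + ε^{-2/3}‖Γ‖²_∞)/r(t)² ∫_{r ≥ r(t)/2} |∇(u_r/r)|²`."

The components `∂ᵣW, ∂_zW` of the gradient of the axisymmetric scalar `W = u_r/r` are not `C¹`
scalars on `ℝ³` (the frame `e_r` is singular on the axis), so instead of applying the tree's (2.4)
(`Wei2016.integral_swirlVelocity_sq_mul_sq_le`, for axisymmetric `C¹` scalars `F`) to them, this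
file applies it to the regularised gradient length `F_δ = √(|∇W|² + δ²) − δ` (`δ > 0`), an
axisymmetric `C¹` scalar with `F_δ² ≤ |∇W|²`, `F_δ² ↑ |∇W|²` (`δ ↓ 0`) and
`(∂ᵣF_δ)² ≤ Σᵢ (∂ᵣ∂ᵢW)² ≤ Σᵢⱼ (∂ⱼ∂ᵢW)²` pointwise, and passes to the limit:

* `Wei2016.isAxisymmetricScalar_gradSq` — `|∇W|² = Σᵢ(∂ᵢW)²` is an axisymmetric scalar
  (`= r² q_W² + (∂₂W)²`, `q_W = (∂ᵣW)/r`);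
* `Wei2016.sq_fderiv_regGrad_le` — the pointwise bound `(∂ᵥF_δ)² ≤ ‖v‖² Σᵢⱼ(∂ⱼ∂ᵢW)²`;
* `Wei2016.integral_swirlVelocity_sq_mul_gradSq_le` — **(3.5) before Lemma 2.1**: under the
  hypotheses of Lemma 2.3 (`|Γ| ≤ ε` on `{r ≤ r₁}`, `|Γ| ≤ Γ_b`, `∫₀ʳ|u_θ| ≤ r a` along rays,
  `0 < r₁ ≤ εK/a`, `K ≥ 1`), for an axisymmetric scalar `W ∈ C²` with `u_θ²|∇W|², |∇W|²,
  Σᵢⱼ(∂ⱼ∂ᵢW)² ∈ L¹`: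
  `∫ u_θ² |∇W|² ≤ εM ∫ Σᵢⱼ(∂ⱼ∂ᵢW)² + C (Γ_b² + εM)/r₁² ∫_{r > r₁/2} |∇W|²`,
  `εM = ε²(1 + ln K + ½ln²K)` (`= ε^{2/3}` for `K = K(ε)`), `C = hardyConst`.

With `∫ Σᵢⱼ(∂ⱼ∂ᵢW)² = ∫ (ΔW)² ≤ ∫ (∂_zΩ)²` (Lemma 2.1, tree `integral_laplacian_radVelQuot_sq_le`)
this is (3.5).

## References

* D. Wei, arXiv:1508.03318, §3 (3.5), with Lemma 2.3 (2.4). [Wei2016]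
-/

noncomputable section

open MeasureTheory Set Function Filter Topology intervalIntegral WithLp
open scoped ENNReal Topology RealInnerProductSpace

namespace Literature.Analysis.FluidPDE

namespace Wei2016

variable {W : EuclideanSpace ℝ (Fin 3) → ℝ}

/-! ### The squared gradient of an axisymmetric scalar -/

/-- The unit radial vector has norm `≤ 1` (`= 1` off the axis, `0` on it). [folklore] -/
theorem norm_eR_le_one' (x : EuclideanSpace ℝ (Fin 3)) : ‖eR x‖ ≤ 1 := by
  by_cases hx : cylRadius x = 0
  · simp [eR, hx]
  · have h : ‖eR x‖ ^ 2 = 1 := by rw [← real_inner_self_eq_norm_sq, inner_eR_self hx]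
    nlinarith [norm_nonneg (eR x)]

/-- **`|∇W|²` is an axisymmetric scalar** for an axisymmetric scalar `W ∈ C²`:
`(∂₀W)² + (∂₁W)² + (∂₂W)² = r² q_W² + (∂₂W)²` with `q_W = radDerivQuot W` (`∂ᵢW = xᵢ q_W`,
`i = 0, 1`), and `q_W`, `∂₂W`, `r²` are axisymmetric. [folklore] -/
theorem isAxisymmetricScalar_gradSq (hW : IsAxisymmetricScalar W) (hWd : ContDiff ℝ 2 W) :
    IsAxisymmetricScalar fun x => fderiv ℝ W x (EuclideanSpace.single 0 1) ^ 2 +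
      fderiv ℝ W x (EuclideanSpace.single 1 1) ^ 2 + fderiv ℝ W x (EuclideanSpace.single 2 1) ^ 2 := by
  have hq : IsAxisymmetricScalar (radDerivQuot W) := isAxisymmetricScalar_radDerivQuot hWd hW
  have hz : IsAxisymmetricScalar fun x => fderiv ℝ W x (EuclideanSpace.single 2 1) :=
    hW.fderiv_apply_single_two (hWd.differentiable two_ne_zero)
  have he : ∀ x, fderiv ℝ W x (EuclideanSpace.single 0 1) ^ 2 + fderiv ℝ W x (EuclideanSpace.single 1 1) ^ 2 =
      cylRadius x ^ 2 * radDerivQuot W x ^ 2 := fun x => by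
    rw [← mul_radDerivQuot_eq_fderiv_zero hWd hW x, ← mul_radDerivQuot_eq_fderiv_one hWd hW x,
      cylRadius_sq]
    ring
  intro θ x
  simp only [he, hq θ x, hz θ x, cylRadius_rotZ]

/-! ### The regularised gradient length -/

/-- **Pointwise bound for the derivative of `F_δ = √(N + δ²) − δ`, `N = Σᵢ(∂ᵢW)²`**:
`(∂ᵥF_δ)² ≤ ‖v‖² Σᵢⱼ (∂ⱼ∂ᵢW)²` for `W ∈ C²`, `δ > 0` and every `x, v`
(`∂ᵥF_δ = Σᵢ ∂ᵢW ∂ᵥ∂ᵢW / √(N + δ²)`, Cauchy–Schwarz twice, `N/(N + δ²) ≤ 1`,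
`(∂ᵥ∂ᵢW)² = (Σⱼ vⱼ∂ⱼ∂ᵢW)² ≤ ‖v‖² Σⱼ(∂ⱼ∂ᵢW)²`). [folklore] -/
theorem sq_fderiv_regGrad_le (hWd : ContDiff ℝ 2 W) {δ : ℝ} (hδ : 0 < δ)
    (x v : EuclideanSpace ℝ (Fin 3)) :
    fderiv ℝ (fun y => Real.sqrt (∑ i : Fin 3, fderiv ℝ W y (EuclideanSpace.single i 1) ^ 2 + δ ^ 2) - δ)
        x v ^ 2 ≤
      ‖v‖ ^ 2 * ∑ i : Fin 3, ∑ j : Fin 3,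
        fderiv ℝ (fun y => fderiv ℝ W y (EuclideanSpace.single i 1)) x (EuclideanSpace.single j 1) ^ 2 := by
  -- names
  set e : Fin 3 → EuclideanSpace ℝ (Fin 3) := fun i => EuclideanSpace.single i 1 with he
  set g : Fin 3 → EuclideanSpace ℝ (Fin 3) → ℝ := fun i y => fderiv ℝ W y (e i) with hg
  set N : EuclideanSpace ℝ (Fin 3) → ℝ := fun y => ∑ i, g i y ^ 2 with hN
  have hg1 : ∀ i, ContDiff ℝ 1 (g i) := fun i =>
    contDiff_fderiv_apply_const_succ (n := 1) (by exact_mod_cast hWd) _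
  have hgd : ∀ i, DifferentiableAt ℝ (g i) x := fun i => ((hg1 i).differentiable one_ne_zero) x
  have hNd : DifferentiableAt ℝ N x := by
    simp only [hN]
    exact DifferentiableAt.fun_sum fun i _ => (hgd i).pow 2
  have hNδ : ∀ y, 0 < N y + δ ^ 2 := fun y => by
    have : 0 ≤ N y := Finset.sum_nonneg fun i _ => sq_nonneg _
    positivity
  -- the derivative of `F_δ`
  have hsq : DifferentiableAt ℝ (fun y => Real.sqrt (N y + δ ^ 2)) x :=
    (hNd.add_const _).sqrt (hNδ x).ne'
  have hF : fderiv ℝ (fun y => Real.sqrt (N y + δ ^ 2) - δ) x v =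
      (∑ i, g i x * fderiv ℝ (g i) x v) / Real.sqrt (N x + δ ^ 2) := by
    rw [fderiv_sub_const, fderiv_sqrt (hNd.add_const _) (hNδ x).ne', fderiv_add_const]
    simp only [_root_.smul_apply, smul_eq_mul]
    have hDN' : HasFDerivAt N (∑ i, (2 • g i x ^ (2 - 1)) • fderiv ℝ (g i) x) x := by
      show HasFDerivAt (fun y => ∑ i, g i y ^ 2) _ x
      exact HasFDerivAt.fun_sum fun i _ => (hgd i).hasFDerivAt.pow 2
    have hDN : fderiv ℝ N x v = ∑ i, 2 * g i x * fderiv ℝ (g i) x v := by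
      rw [hDN'.fderiv, FunLike.coe_sum, Finset.sum_apply]
      refine Finset.sum_congr rfl fun i _ => ?_
      rw [_root_.smul_apply, smul_eq_mul, nsmul_eq_mul]
      norm_num
    rw [hDN, show (∑ i, 2 * g i x * fderiv ℝ (g i) x v) = 2 * ∑ i, g i x * fderiv ℝ (g i) x v by
      rw [Finset.mul_sum]; exact Finset.sum_congr rfl fun i _ => by ring]
    have hs : 0 < Real.sqrt (N x + δ ^ 2) := Real.sqrt_pos.2 (hNδ x)
    field_simp
  -- the function in the statement is this one
  have hfun : (fun y => Real.sqrt (∑ i : Fin 3, fderiv ℝ W y (EuclideanSpace.single i 1) ^ 2 + δ ^ 2) - δ) =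
      fun y => Real.sqrt (N y + δ ^ 2) - δ := rfl
  rw [hfun, hF]
  -- Cauchy–Schwarz: `(Σ gᵢ aᵢ)² ≤ (Σ gᵢ²)(Σ aᵢ²) ≤ (N + δ²) Σ aᵢ²`
  set a : Fin 3 → ℝ := fun i => fderiv ℝ (g i) x v with ha
  rw [div_pow, Real.sq_sqrt (hNδ x).le]
  have h1 : (∑ i, g i x * a i) ^ 2 ≤ N x * ∑ i, a i ^ 2 := by
    have h := Finset.sum_mul_sq_le_sq_mul_sq Finset.univ (fun i => g i x) a
    simpa only [hN] using h
  have ha0 : 0 ≤ ∑ i, a i ^ 2 := Finset.sum_nonneg fun i _ => sq_nonneg _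
  have h2 : (∑ i, g i x * a i) ^ 2 / (N x + δ ^ 2) ≤ ∑ i, a i ^ 2 := by
    rw [div_le_iff₀ (hNδ x)]
    nlinarith [h1, mul_nonneg ha0 (sq_nonneg δ)]
  -- `aᵢ² ≤ ‖v‖² Σⱼ (∂ⱼgᵢ)²`
  have hvn : ‖v‖ ^ 2 = ∑ j, v j ^ 2 := by
    rw [EuclideanSpace.norm_eq, Real.sq_sqrt (Finset.sum_nonneg fun j _ => by positivity)]
    simp only [Real.norm_eq_abs, sq_abs]
  have h3 : ∀ i, a i ^ 2 ≤ ‖v‖ ^ 2 * ∑ j, fderiv ℝ (g i) x (e j) ^ 2 := by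
    intro i
    have hv : v = ∑ j, v j • e j := by
      ext k
      fin_cases k <;> simp [he, Fin.sum_univ_three]
    have hexp : a i = ∑ j, v j * fderiv ℝ (g i) x (e j) := by
      show fderiv ℝ (g i) x v = _
      conv_lhs => rw [hv]
      simp only [map_sum, map_smul, smul_eq_mul]
    rw [hexp, hvn]
    exact Finset.sum_mul_sq_le_sq_mul_sq Finset.univ (fun j => v j) fun j => fderiv ℝ (g i) x (e j)
  calc (∑ i, g i x * a i) ^ 2 / (N x + δ ^ 2) ≤ ∑ i, a i ^ 2 := h2
    _ ≤ ∑ i, ‖v‖ ^ 2 * ∑ j, fderiv ℝ (g i) x (e j) ^ 2 := Finset.sum_le_sum fun i _ => h3 i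
    _ = ‖v‖ ^ 2 * ∑ i : Fin 3, ∑ j : Fin 3,
        fderiv ℝ (fun y => fderiv ℝ W y (EuclideanSpace.single i 1)) x (EuclideanSpace.single j 1) ^ 2 := by
        rw [← Finset.mul_sum]

/-! ### (2.4) for the gradient of an axisymmetric scalar -/

/-- `u_θ = r⁻¹ Γ` is measurable for a continuous field (`e_θ` is discontinuous on the axis, but
`u_θ = (cylRadius)⁻¹ · swirl u` with `swirl u` continuous). [folklore] -/
theorem measurable_swirlVelocity {u : EuclideanSpace ℝ (Fin 3) → EuclideanSpace ℝ (Fin 3)}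
    (huc : Continuous u) : Measurable (swirlVelocity u) := by
  have he : swirlVelocity u = fun x => (cylRadius x)⁻¹ * swirl u x := by
    funext x
    rw [swirlVelocity, show eTheta x = (cylRadius x)⁻¹ • rotGen x from rfl, real_inner_smul_right,
      real_inner_comm, congrFun (swirl_eq_inner_rotGen u) x]
  rw [he]
  have hsw : Continuous (swirl u) := by
    have h0 : Continuous fun x : EuclideanSpace ℝ (Fin 3) => u x 0 :=
      (EuclideanSpace.proj (0 : Fin 3)).continuous.comp huc
    have h1 : Continuous fun x : EuclideanSpace ℝ (Fin 3) => u x 1 :=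
      (EuclideanSpace.proj (1 : Fin 3)).continuous.comp huc
    have hc0 : Continuous fun x : EuclideanSpace ℝ (Fin 3) => x 0 := (EuclideanSpace.proj (0 : Fin 3)).continuous
    have hc1 : Continuous fun x : EuclideanSpace ℝ (Fin 3) => x 1 := (EuclideanSpace.proj (1 : Fin 3)).continuous
    show Continuous fun x => x 0 * u x 1 - x 1 * u x 0
    exact (hc0.mul h1).sub (hc1.mul h0)
  exact (continuous_cylRadius.measurable.inv).mul hsw.measurable

/-- The radial derivative `x ↦ DF(x)[e_r(x)]` of a `C¹` scalar is measurable
(`e_r = (cylRadius)⁻¹ x_h` with `x_h` continuous). [folklore] -/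
theorem measurable_partialDeriv_eR {F : EuclideanSpace ℝ (Fin 3) → ℝ} (hF : ContDiff ℝ 1 F) :
    Measurable fun x => partialDeriv (eR x) F x := by
  have hc0 : Continuous fun x : EuclideanSpace ℝ (Fin 3) => x 0 := (EuclideanSpace.proj (0 : Fin 3)).continuous
  have hc1 : Continuous fun x : EuclideanSpace ℝ (Fin 3) => x 1 := (EuclideanSpace.proj (1 : Fin 3)).continuous
  have hD : Continuous (fderiv ℝ F) := hF.continuous_fderiv one_ne_zero
  have he : (fun x => partialDeriv (eR x) F x) =
      fun x => (cylRadius x)⁻¹ * (x 0 * fderiv ℝ F x (EuclideanSpace.single 0 1) +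
        x 1 * fderiv ℝ F x (EuclideanSpace.single 1 1)) := by
    funext x
    rw [partialDeriv, eR, map_smul, smul_eq_mul, toLp_horizontal_eq_add_single, map_add, map_smul,
      map_smul, smul_eq_mul, smul_eq_mul]
  rw [he]
  exact (continuous_cylRadius.measurable.inv).mul
    ((hc0.mul (hD.clm_apply continuous_const)).add (hc1.mul (hD.clm_apply continuous_const))).measurable


/-- **Wei 2016, (3.5) before Lemma 2.1: `∫ u_θ²|∇W|² ≤ εM ∫ Σᵢⱼ(∂ⱼ∂ᵢW)² + C(Γ_b² + εM)/r₁² ∫_{r>r₁/2}|∇W|²`.**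
Let `u` be continuous and axisymmetric with `|Γ| ≤ ε` on `{0 < r ≤ r₁}`, `|Γ| ≤ Γ_b` everywhere
and `∫₀ʳ |u_θ(s,0,z)| ds ≤ r a` for `0 < r ≤ r₁` (`Γ = swirl u`, `u_θ = swirlVelocity u`), with
`0 < ε`, `0 < a`, `1 ≤ K`, `0 < r₁ ≤ εK/a`; let `W ∈ C²` be an axisymmetric scalar with
`u_θ²|∇W|²`, `|∇W|²`, `Σᵢⱼ(∂ⱼ∂ᵢW)²` integrable. Then, with `M = ε(1 + ln K + ½ ln²K)`,
`∫ u_θ²|∇W|² ≤ εM ∫ Σᵢⱼ(∂ⱼ∂ᵢW)² + hardyConst (Γ_b² + εM)/r₁² ∫_{r₁/2 < r} |∇W|²`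
(`|∇W|² = Σᵢ(∂ᵢW)²`). Proof: (2.4) (`integral_swirlVelocity_sq_mul_sq_le`) for the axisymmetric `C¹`
scalars `F_δ = √(|∇W|² + δ²) − δ`, `F_δ² ≤ |∇W|²`, `(∂ᵣF_δ)² ≤ Σᵢⱼ(∂ⱼ∂ᵢW)²`
(`sq_fderiv_regGrad_le`), and dominated convergence `F_δ² → |∇W|²` (`δ ↓ 0`).
[cite: Wei2016, §3 (3.5) with Lemma 2.3 (2.4)] -/
theorem integral_swirlVelocity_sq_mul_gradSq_le
    {u : EuclideanSpace ℝ (Fin 3) → EuclideanSpace ℝ (Fin 3)} {ε a K r₁ Γb : ℝ}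
    (hu : IsAxisymmetric u) (huc : Continuous u) (hW : IsAxisymmetricScalar W)
    (hWd : ContDiff ℝ 2 W) (hε : 0 < ε) (ha : 0 < a) (hK : 1 ≤ K) (hr₁ : 0 < r₁)
    (hr₁K : r₁ ≤ ε * K / a)
    (hΓε : ∀ x, 0 < cylRadius x → cylRadius x ≤ r₁ → |swirl u x| ≤ ε)
    (hΓb : ∀ x, |swirl u x| ≤ Γb)
    (hv : ∀ z r : ℝ, 0 < r → r ≤ r₁ →
      ∫ s in (0 : ℝ)..r, |swirlVelocity u (meridianPoint (s, z))| ≤ r * a)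
    (hSi : Integrable fun x => swirlVelocity u x ^ 2 *
      (fderiv ℝ W x (EuclideanSpace.single 0 1) ^ 2 + fderiv ℝ W x (EuclideanSpace.single 1 1) ^ 2 +
        fderiv ℝ W x (EuclideanSpace.single 2 1) ^ 2))
    (hGi : Integrable fun x => fderiv ℝ W x (EuclideanSpace.single 0 1) ^ 2 +
      fderiv ℝ W x (EuclideanSpace.single 1 1) ^ 2 + fderiv ℝ W x (EuclideanSpace.single 2 1) ^ 2)
    (hHi : Integrable fun x => ∑ i : Fin 3, ∑ j : Fin 3,
      fderiv ℝ (fun y => fderiv ℝ W y (EuclideanSpace.single i 1)) x (EuclideanSpace.single j 1) ^ 2) :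
    ∫ x, swirlVelocity u x ^ 2 *
        (fderiv ℝ W x (EuclideanSpace.single 0 1) ^ 2 + fderiv ℝ W x (EuclideanSpace.single 1 1) ^ 2 +
          fderiv ℝ W x (EuclideanSpace.single 2 1) ^ 2) ≤
      ε * (ε * (1 + Real.log K + Real.log K ^ 2 / 2)) *
          (∫ x, ∑ i : Fin 3, ∑ j : Fin 3,
            fderiv ℝ (fun y => fderiv ℝ W y (EuclideanSpace.single i 1)) x (EuclideanSpace.single j 1) ^ 2) +
        hardyConst * (Γb ^ 2 + ε * (ε * (1 + Real.log K + Real.log K ^ 2 / 2))) / r₁ ^ 2 *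
          ∫ x in {x | r₁ / 2 < cylRadius x},
            (fderiv ℝ W x (EuclideanSpace.single 0 1) ^ 2 + fderiv ℝ W x (EuclideanSpace.single 1 1) ^ 2 +
              fderiv ℝ W x (EuclideanSpace.single 2 1) ^ 2) := by
  -- names: `N = |∇W|²` (as a three-term sum), `H = Σᵢⱼ (∂ⱼ∂ᵢW)²`, the constants
  set e : Fin 3 → EuclideanSpace ℝ (Fin 3) := fun i => EuclideanSpace.single i 1 with he
  set N : EuclideanSpace ℝ (Fin 3) → ℝ := fun x =>
    fderiv ℝ W x (e 0) ^ 2 + fderiv ℝ W x (e 1) ^ 2 + fderiv ℝ W x (e 2) ^ 2 with hN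
  set H : EuclideanSpace ℝ (Fin 3) → ℝ := fun x => ∑ i : Fin 3, ∑ j : Fin 3,
    fderiv ℝ (fun y => fderiv ℝ W y (e i)) x (e j) ^ 2 with hH
  set M₁ : ℝ := ε * (ε * (1 + Real.log K + Real.log K ^ 2 / 2)) with hM₁
  set C₂ : ℝ := hardyConst * (Γb ^ 2 + M₁) / r₁ ^ 2 with hC₂
  change ∫ x, swirlVelocity u x ^ 2 * N x ≤ M₁ * (∫ x, H x) + C₂ * ∫ x in {x | r₁ / 2 < cylRadius x}, N x
  have hNsum : ∀ x, N x = ∑ i : Fin 3, fderiv ℝ W x (e i) ^ 2 := fun x => by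
    simp only [hN, Fin.sum_univ_three]
  have hN0 : ∀ x, 0 ≤ N x := fun x => by simp only [hN]; positivity
  have hH0 : ∀ x, 0 ≤ H x := fun x =>
    Finset.sum_nonneg fun i _ => Finset.sum_nonneg fun j _ => sq_nonneg _
  -- constants are nonnegative
  have hlogK : 0 ≤ Real.log K := Real.log_nonneg hK
  have hM₁0 : 0 ≤ M₁ := by simp only [hM₁]; positivity
  have hC₂0 : 0 ≤ C₂ := by
    simp only [hC₂]
    exact div_nonneg (mul_nonneg hardyConst_nonneg (by positivity)) (sq_nonneg _)
  -- smoothness of `N`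
  have hg1 : ∀ i, ContDiff ℝ 1 fun y => fderiv ℝ W y (e i) := fun i =>
    contDiff_fderiv_apply_const_succ (n := 1) (by exact_mod_cast hWd) _
  have hN1 : ContDiff ℝ 1 N := by
    simp only [hN]
    exact (((hg1 0).pow 2).add ((hg1 1).pow 2)).add ((hg1 2).pow 2)
  have hNc : Continuous N := hN1.continuous
  have hNax : IsAxisymmetricScalar N := isAxisymmetricScalar_gradSq hW hWd
  -- the regularised scalars `F δ`
  set F : ℝ → EuclideanSpace ℝ (Fin 3) → ℝ := fun δ x => Real.sqrt (N x + δ ^ 2) - δ with hF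
  have hFax : ∀ δ, IsAxisymmetricScalar (F δ) := fun δ θ x => by simp only [hF, hNax θ x]
  have hF1 : ∀ δ, 0 < δ → ContDiff ℝ 1 (F δ) := fun δ hδ => by
    simp only [hF]
    refine ContDiff.sub (ContDiff.sqrt (hN1.add contDiff_const) fun x => ?_) contDiff_const
    have := hN0 x
    positivity
  have hF0 : ∀ δ, 0 ≤ δ → ∀ x, 0 ≤ F δ x := fun δ hδ x => by
    simp only [hF, sub_nonneg]
    calc δ = Real.sqrt (δ ^ 2) := (Real.sqrt_sq hδ).symm
      _ ≤ Real.sqrt (N x + δ ^ 2) := Real.sqrt_le_sqrt (by linarith [hN0 x])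
  have hFsq : ∀ δ, 0 ≤ δ → ∀ x, F δ x ^ 2 ≤ N x := by
    intro δ hδ x
    have h0 := hF0 δ hδ x
    have hs : Real.sqrt (N x + δ ^ 2) ^ 2 = N x + δ ^ 2 := Real.sq_sqrt (by nlinarith [hN0 x, sq_nonneg δ])
    simp only [hF] at h0 ⊢
    nlinarith [Real.sqrt_nonneg (N x + δ ^ 2)]
  have hFderiv : ∀ δ, 0 < δ → ∀ x, partialDeriv (eR x) (F δ) x ^ 2 ≤ H x := by
    intro δ hδ x
    have h := sq_fderiv_regGrad_le hWd hδ x (eR x)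
    have hfun : (fun y => Real.sqrt (∑ i : Fin 3, fderiv ℝ W y (EuclideanSpace.single i 1) ^ 2 + δ ^ 2) - δ) =
        F δ := by
      funext y
      simp only [hF, hNsum]
      rfl
    rw [hfun] at h
    refine (h.trans ?_)
    have h1 : ‖eR x‖ ^ 2 ≤ 1 := by
      have := norm_eR_le_one' x
      nlinarith [norm_nonneg (eR x)]
    calc ‖eR x‖ ^ 2 * H x ≤ 1 * H x := mul_le_mul_of_nonneg_right h1 (hH0 x)
      _ = H x := one_mul _
  -- (2.4) for each `F δ`
  have hstep : ∀ δ, 0 < δ →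
      ∫ x, swirlVelocity u x ^ 2 * F δ x ^ 2 ≤ M₁ * (∫ x, H x) + C₂ * ∫ x in {x | r₁ / 2 < cylRadius x}, N x := by
    intro δ hδ
    have hFc : Continuous (F δ) := (hF1 δ hδ).continuous
    -- integrability of the three integrands
    have hsvm : Measurable (swirlVelocity u) := measurable_swirlVelocity huc
    have hAi : Integrable fun x => swirlVelocity u x ^ 2 * F δ x ^ 2 := by
      refine hSi.mono ((hsvm.pow_const 2).mul (hFc.measurable.pow_const 2)).aestronglyMeasurable
        (Eventually.of_forall fun x => ?_)
      simp only [Real.norm_eq_abs]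
      rw [abs_of_nonneg (by positivity), abs_of_nonneg (mul_nonneg (sq_nonneg _) (hN0 x))]
      exact mul_le_mul_of_nonneg_left (hFsq δ hδ.le x) (sq_nonneg _)
    have hBi : Integrable fun x => partialDeriv (eR x) (F δ) x ^ 2 := by
      have hc : Measurable fun x => partialDeriv (eR x) (F δ) x := measurable_partialDeriv_eR (hF1 δ hδ)
      refine hHi.mono (hc.pow_const 2).aestronglyMeasurable (Eventually.of_forall fun x => ?_)
      simp only [Real.norm_eq_abs]
      rw [abs_of_nonneg (sq_nonneg _), abs_of_nonneg (hH0 x)]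
      exact hFderiv δ hδ x
    have hCi : Integrable fun x => F δ x ^ 2 := by
      refine hGi.mono (hFc.pow 2).aestronglyMeasurable (Eventually.of_forall fun x => ?_)
      simp only [Real.norm_eq_abs]
      rw [abs_of_nonneg (sq_nonneg _), abs_of_nonneg (hN0 x)]
      exact hFsq δ hδ.le x
    have h := integral_swirlVelocity_sq_mul_sq_le hu huc (hFax δ) (hF1 δ hδ) hε ha hK hr₁ hr₁K hΓε hΓb
      hv hAi hBi hCi
    rw [← hM₁, ← hC₂] at h
    -- bound the right-hand side
    have hB : ∫ x, partialDeriv (eR x) (F δ) x ^ 2 ≤ ∫ x, H x :=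
      integral_mono hBi hHi fun x => hFderiv δ hδ x
    have hC : ∫ x in {x | r₁ / 2 < cylRadius x}, F δ x ^ 2 ≤ ∫ x in {x | r₁ / 2 < cylRadius x}, N x :=
      setIntegral_mono hCi.integrableOn hGi.integrableOn fun x => hFsq δ hδ.le x
    calc ∫ x, swirlVelocity u x ^ 2 * F δ x ^ 2
        ≤ M₁ * (∫ x, partialDeriv (eR x) (F δ) x ^ 2) +
          C₂ * ∫ x in {x | r₁ / 2 < cylRadius x}, F δ x ^ 2 := h
      _ ≤ M₁ * (∫ x, H x) + C₂ * ∫ x in {x | r₁ / 2 < cylRadius x}, N x := by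
          gcongr
  -- `δ ↓ 0`: dominated convergence
  have hlim : Tendsto (fun n : ℕ => ∫ x, swirlVelocity u x ^ 2 * F (1 / ((n : ℝ) + 1)) x ^ 2) atTop
      (𝓝 (∫ x, swirlVelocity u x ^ 2 * N x)) := by
    have hsvm : Measurable (swirlVelocity u) := measurable_swirlVelocity huc
    refine tendsto_integral_of_dominated_convergence (fun x => swirlVelocity u x ^ 2 * N x)
      (fun n => ((hsvm.pow_const 2).mul
        ((hF1 _ (by positivity)).continuous.measurable.pow_const 2)).aestronglyMeasurable)
      hSi (fun n => Eventually.of_forall fun x => ?_) (Eventually.of_forall fun x => ?_)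
    · rw [Real.norm_eq_abs, abs_of_nonneg (by positivity)]
      exact mul_le_mul_of_nonneg_left (hFsq _ (by positivity) x) (sq_nonneg _)
    · -- pointwise convergence `F_δ(x)² → N(x)`
      have hδ : Tendsto (fun n : ℕ => (1 : ℝ) / ((n : ℝ) + 1)) atTop (𝓝 0) :=
        tendsto_one_div_add_atTop_nhds_zero_nat
      have hcont : Continuous fun δ : ℝ => swirlVelocity u x ^ 2 * (Real.sqrt (N x + δ ^ 2) - δ) ^ 2 := by
        fun_prop
      have h := (hcont.tendsto 0).comp hδ
      have h0 : swirlVelocity u x ^ 2 * (Real.sqrt (N x + 0 ^ 2) - 0) ^ 2 = swirlVelocity u x ^ 2 * N x := by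
        simp [Real.sq_sqrt (hN0 x)]
      rw [h0] at h
      simpa [hF, Function.comp_def] using h
  refine le_of_tendsto hlim (Eventually.of_forall fun n => hstep _ (by positivity))

end Wei2016

end Literature.Analysis.FluidPDE

end
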